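import Literature.Geometry.Kaehler.ComplexTorusIsogenyClassTrivialEndomorphisms
import Literature.Geometry.Kaehler.ComplexTorusCyclicGroupAction
import Literature.Geometry.Kaehler.ComplexTorusLefschetzNumber
import Literature.Geometry.Kaehler.ComplexTorusNeronSeveriEndomorphisms
import Literature.Geometry.Kaehler.ComplexTorusTateModuleHom
import Mathlib.RingTheory.Polynomial.Cyclotomic.Eval
import Mathlib.Algebra.Module.ZMod
import Mathlib.Algebra.Field.ZMod
import Mathlib.FieldTheory.Finiteness
import Mathlib.LinearAlgebra.Dimension.Free
import HarnessLib

/-!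
# Automorphisms `δ` with `Φ_ℓ(δ) = 0`: the ring `ℤ[δ]`, the fixed group `A^δ ≅ 𝔽_ℓ^{2 dim A/(ℓ-1)}`, and `End_δ(A)` acting on `A^δ` (Dolgachev–Zarhin 2024, §2.2, (2.15)–(2.19), Remark 2.17, Lemma 2.19)

Layer `Literature/Geometry/Kaehler`, namespace `Literature.Geometry.Kaehler.ComplexTorus`; lane
`lit-hodgefound` (Layer A2, row «A2-26(w)», prover p11 gen 7, the sequel of
`ComplexTorusIsogenyClassTrivialEndomorphisms.lean` (row «A2-26(v)»: DZ24 §2.1, whose Claim 2.7 is used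
here exactly where the notes use it), on the tree's carriers `endRingInt Φ = End(X)`
(`ComplexTorusNeronSeveriEndomorphisms`), `Fix(f) = Ker(1_X - f)` (`ComplexTorusLefschetzNumber`) and the
cyclotomic matrix algebra of `ComplexTorusCyclicGroupAction` (`Φ_d(M) = 0 ⇒ minpoly = Φ_d`,
`P_M = Φ_d^{r}`, `φ(d) ∣` size).

Source: I. Dolgachev, Yu. G. Zarhin, *Endomorphisms of Complex Abelian Varieties* (lecture notes dated
July 31, 2024; held copy `paper:galaxy-pdf-8712177384607648460`, "chunk" = file of the held text, key
`DolgachevZarhin2024`), Chapter 2, §2.2, VERBATIM [chunks p0033–p0037]: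

> Let `ℓ` be an odd prime and `δ` be an automorphism of a positive-dimensional abelian variety `A = V/Λ`
> that satisfies the `ℓ`th cyclotomic equation `Φ_ℓ(δ) = Σ_{j=0}^{ℓ-1} δ^j = 0` in `End(A)`. Clearly `δ^ℓ`
> is the identity automorphism of `A` and the subgroup of fixed points of `δ`,
> `A^δ = {x ∈ A ∣ δ(x) = x}`, is contained in `A[ℓ]`, and therefore, may be viewed as a
> finite-dimensional `𝔽_ℓ`-vector space. In order to find its dimension, notice that the subring `ℤ[δ]`
> of `End(A)` is isomorphic to the `ℓ`th cyclotomic ring `ℤ[ζ_ℓ]` […]. Let us consider the surjective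
> ring homomorphism `ℤ[t]/(Φ_ℓ(t)) → ℤ[δ]`, `P(t) + Φ_ℓ(t)ℤ[t] ↦ P(δ)` (2.15). Suppose that the map
> (2.15) is *not* injective. This means that there is a polynomial `𝒫(t) ∈ ℤ[t]` *not* divisible by
> `Φ_ℓ(t)` such that `𝒫(δ) = 0`. […] The obtained contradiction proves that the map (2.15) is
> injective, and therefore, is a ring isomorphism. It follows that the composition of ring isomorphisms
> `ℤ[ζ_ℓ] → ℤ[t]/(Φ_ℓ(t)) → ℤ[δ]` (2.16) is also a *ring isomorphism*. […] The `ℤ`-rank arguments imply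
> that `2 dim(A) = r(ℓ - 1)`. Thus […] `r = 2dim(A)/(ℓ - 1)`, and, therefore,
> `A^δ = (1-δ)⁻¹Λ/Λ ≅ Λ/(1-δ)Λ ≅ ℤ[ζ_ℓ]^r/(1-ζ_ℓ)ℤ[ζ_ℓ]^r = 𝔽_ℓ^r`. This implies that
> `dim_{𝔽_ℓ}(A^δ) = r = 2dim(A)/(ℓ - 1)`.
>
> Let `End_δ(A)` be the centralizer of `δ` in `End(A)`. […] The rational representation of elements of
> `End_δ(A)` gives us the ring embedding `End_δ(A) ↪ End_ℤ(Λ)`. Its image lies in `End_{ℤ[δ]}(Λ)`,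
> which gives us an embedding of `ℤ[δ]`-algebras `μ_r : End_δ(A) ↪ End_{ℤ[δ]}(Λ)`, `f ↦ f_r` (2.17).
> **Remark 2.17.** […] there is a positive integer `N` such that `N · End_{ℤ[δ]}(Λ) ⊂ ι_r(End_δ(A))`. We
> claim that in this case the embedding (2.17) is bijective […] `ι_r(End_δ(A)) = End_{ℤ[δ]}(Λ)` (2.18).
> […] Then, `Nu ∈ End_δ(A)`. […] Thus, `(1/N)(Nu)_ℝ` is also a `ℂ`-linear self-map of `V`. […] we
> conclude that `u ∈ End(A)`.
>
> **Lemma 2.19.** Let `u ∈ End(A)_δ ⊂ End(A)`. Then: (i) `u(A^δ) ⊂ A^δ`;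
> (ii) `u(A^δ) = {0}` if and only if `u ∈ (1 - δ)End(A)_δ`.
> [(2.19): "the action of `End_δ(A)` on `A^δ` induces the `𝔽_ℓ`-algebra embedding
> `End_δ(A)/(1-δ)End_δ(A) ↪ End_{𝔽_ℓ}(A^δ)`, `u + (1-δ)End_δ(A) ↦ {x ↦ u(x) ∀ x ∈ A^δ}`."]
> *Proof of Lemma 2.19.* (i) is obvious. Notice that *if* part in (ii) is obvious. In order to prove
> the *only if* part recall that there is `λ ∈ ℤ[ζ_ℓ]` such that `λ(1 - ζ_ℓ) = ℓ`. This shows the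
> existence of `v ∈ ℤ[δ]` such that `v(1 - δ) = (1 - δ)v = ℓ` in `End_δ(A)`. This implies that
> `v(A[ℓ]) ⊂ A^δ`. It follows that `u(A^δ) = {0}`, hence `uv(A[ℓ]) = {0}` and, therefore, there is
> `w ∈ End(A)` such that `vu = uv = ℓw = v(1 - δ)w` and, hence, `u = (1 - δ)w`. Clearly,
> `w ∈ End_δ(A)`.

## Lean rendering

`A = X = ComplexTorus Φ = E/Φ(ℤ^ι)`; `δ = ρ(D) = mapMatrix Φ Φ D` for an INTEGER MATRIX `D` (its
rational representation) with `Φ_n(D) = 0` (`aeval D (cyclotomic n ℤ) = 0`). The notes take `n = ℓ` an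
odd prime; every statement below is proved for the `n` (resp. the primes `ℓ`) for which the printed
argument works verbatim, and specialised. `δ ∈ End(A)` (holomorphy) is `D ∈ endRingInt Φ`; it is
needed only for the `End_δ(A)`-statements — the fixed group and the ring `ℤ[δ]` are facts about the
group endomorphism `ρ(D)` of `(ℝ/ℤ)^ι`.

* **(2.15)–(2.16) `ℤ[t]/(Φ_ℓ) ≅ ℤ[δ]`**: `aeval_eq_zero_iff_cyclotomic_dvd` (`P(δ) = 0 ⟺ Φ_n ∣ P` in
  `ℤ[t]` — injectivity of (2.15); Mathlib's minimal polynomial over `ℚ` and Gauss's lemma replace the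
  resultant argument), `ker_aeval_eq_span_cyclotomic` (the kernel of `ℤ[t] → ℤ[δ] ⊆ M_ι(ℤ)` is
  `(Φ_n)`; the range is `ℤ[δ] = Algebra.adjoin ℤ {D}` by `Algebra.adjoin_singleton_eq_range_aeval`, so
  (2.15) is an isomorphism by the first isomorphism theorem), `pow_eq_one_of_aeval_cyclotomic`
  ("`δ^ℓ` is the identity").
* **"`2 dim(A) = r(ℓ - 1)`"**: `totient_dvd_card` (`φ(n) ∣ rk Λ`), `charpoly_eq_cyclotomic_pow`
  (`P_δ = Φ_n^{rk Λ/φ(n)}`), `det_one_sub_eq_pow` (`det(1 - ρ_r(δ)) = Φ_n(1)^{rk Λ/φ(n)}`).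
* **`A^δ`** is `fixedSubgroup Φ D := Ker ρ(1 - D)` (`= Fix(ρ(D))`, `coe_fixedSubgroup`);
  **`#A^δ = Φ_n(1)^{rk Λ/φ(n)}`** (`natCard_fixedSubgroup_eq_pow`), `= ℓ^{2dim A/(ℓ-1)}` for `n = ℓ`
  prime (`natCard_fixedSubgroup_of_prime`), `= p^{rk Λ/φ(p^{k+1})}` for prime powers, and **`A^δ = 0`
  when `n ≥ 2` is not a prime power** (`fixedSubgroup_eq_bot_of_not_isPrimePow`, `Φ_n(1) = 1`);
  **`A^δ ⊆ A[ℓ]`** (`eval_one_cyclotomic_zsmul_eq_zero`: `Φ_n(1) · A^δ = 0`, from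
  `Φ_n(t) - Φ_n(1) = (t - 1)w(t)`, i.e. "`v(1 - δ) = (1 - δ)v = ℓ`" — `exists_one_sub_mul_eq_smul`);
  **`A^δ ≅ 𝔽_ℓ^r`, `r = 2dim(A)/(ℓ - 1)`** (`nonempty_addEquiv_fixedSubgroup`: an `ℓ`-torsion group of
  order `ℓ^r` is `𝔽_ℓ^r`; the notes use `Λ ≅ ⊕ P_j` over the Dedekind ring `ℤ[ζ_ℓ]` — here the count
  `#A^δ = |det(1 - ρ_r(δ))| = Φ_ℓ(1)^r` of `ComplexTorusLefschetzNumber` does the same job).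
* **`End_δ(A)`** is `centralizerEnd Φ D := endRingInt Φ ⊓ centralizer {D}` (so (2.17), "its image lies
  in `End_{ℤ[δ]}(Λ)`", is its definition); **Remark 2.17 / (2.18)** is the tree's
  `mem_endRingInt_of_smul_mem` (`ComplexTorusTateModuleHom`: `End(X)` is saturated in `M_ι(ℤ)`)
  (`Nu ∈ End(A) ⇒ u ∈ End(A)`) and `mem_centralizerEnd_of_zsmul_mem`.
* **Lemma 2.19 (i)** `mapMatrix_mem_fixedSubgroup`; **(ii)** `forall_fixed_eq_zero_iff` — proved as
  printed: `v(A[ℓ]) ⊆ A^δ` (`mapMatrix_mem_fixedSubgroup_of_torsion`), `uv(A[ℓ]) = 0`, hence `uv = ℓw`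
  by CLAIM 2.7 (`forall_torsion_imp_eq_zero_iff_exists_eq_smul` of the §2.1 file), `u = (1 - δ)w`,
  `w ∈ End_δ(A)`; **(2.19)**: the action `fixedAction : End_δ(A) →+* End(A^δ)` and
  **`ker_fixedAction`**: its kernel is the ideal generated by `1 - δ` (so the induced map on
  `End_δ(A)/(1 - δ)End_δ(A)` is injective).

Not here: Theorems 2.15 / 2.18 themselves (their hypothesis "the Galois module `A[ℓ]`, resp. `A^δ`, is
very simple" is arithmetic — a `Gal(K)`-action on torsion points of a model over a finitely generated
field — and has no counterpart on the analytic carrier), and the Dedekind-module decomposition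
`Λ ≅ ⊕ P_j` (replaced by the determinant count, as said).

## Main statements (all proved; definitions with bodies `fixedSubgroup`, `centralizerEnd`, `fixedAction`;
no named fact, net debt 0)

`aeval_eq_zero_iff_cyclotomic_dvd`, `ker_aeval_eq_span_cyclotomic`, `pow_eq_one_of_aeval_cyclotomic`,
`totient_dvd_card`, `charpoly_eq_cyclotomic_pow`, `det_one_sub_eq_pow`, `mem_fixedSubgroup_iff`,
`coe_fixedSubgroup`, `natCard_fixedSubgroup_eq_pow`, `natCard_fixedSubgroup_of_prime`,
`natCard_fixedSubgroup_of_prime_pow`, `fixedSubgroup_eq_bot_of_not_isPrimePow`,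
`exists_one_sub_mul_eq_smul`, `eval_one_cyclotomic_zsmul_eq_zero`, `prime_nsmul_eq_zero_of_mem_fixedSubgroup`,
`nonempty_addEquiv_fixedSubgroup`, `mem_centralizerEnd_of_zsmul_mem`,
`mapMatrix_mem_fixedSubgroup`, `mapMatrix_mem_fixedSubgroup_of_torsion`, `forall_fixed_eq_zero_iff`,
`fixedAction`, `fixedAction_eq_zero_iff`, `ker_fixedAction`.

## References

* [DolgachevZarhin2024] I. Dolgachev, Yu. G. Zarhin, *Endomorphisms of Complex Abelian Varieties*, lecture
  notes (2024), §2.2, (2.15)–(2.19), Remark 2.17, Lemma 2.19 (chunks p0033–p0037 of the held copy).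
* [LangeRodriguez2022] H. Lange, R. E. Rodríguez, *Decomposition of Jacobians by Prym Varieties*, LNM
  2310 (2022), §6.1.1 — the cyclotomic matrix algebra of `ComplexTorusCyclicGroupAction` reused here.
-/

noncomputable section

open Module Matrix Function Polynomial
open scoped Manifold

namespace Literature.Geometry.Kaehler

namespace ComplexTorus

open CyclotomicIdempotents

variable {ι : Type*} [Fintype ι] [DecidableEq ι] {E : Type*} [NormedAddCommGroup E] [NormedSpace ℂ E]

/-! ### §0 Integer-matrix helpers -/

omit [DecidableEq ι] in
/-- `ℤ → ℚ` commutes with polynomial evaluation on matrices. [folklore] -/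
private theorem map_aeval_intCast [DecidableEq ι] (D : Matrix ι ι ℤ) (P : ℤ[X]) :
    (aeval D P).map (Int.cast : ℤ → ℚ) = aeval (D.map (Int.cast : ℤ → ℚ)) (P.map (Int.castRingHom ℚ)) := by
  have h := map_aeval_eq_aeval_map (S := Matrix ι ι ℤ) (U := Matrix ι ι ℚ) (φ := Int.castRingHom ℚ)
    (ψ := (Int.castRingHom ℚ).mapMatrix) (RingHom.ext_int _ _) P D
  simpa only [RingHom.mapMatrix_apply, Int.coe_castRingHom] using h

/-- Cancelling a non-singular integer matrix on the right: `X B = Y B ⇒ X = Y` (`B adj(B) = det B · 1`).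
[folklore] -/
private theorem mul_right_cancel_of_det_ne_zero {B : Matrix ι ι ℤ} (hB : B.det ≠ 0) {X Y : Matrix ι ι ℤ}
    (h : X * B = Y * B) : X = Y := by
  have h' : B.det • X = B.det • Y := by
    rw [← Matrix.mul_one X, ← Matrix.mul_one Y, ← Matrix.mul_smul, ← Matrix.mul_smul, ← Matrix.mul_adjugate,
      ← Matrix.mul_assoc, ← Matrix.mul_assoc, h]
  ext i j
  have hij := congrFun (congrFun h' i) j
  rw [Matrix.smul_apply, Matrix.smul_apply, smul_eq_mul, smul_eq_mul] at hij
  exact mul_left_cancel₀ hB hij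

omit [Fintype ι] [DecidableEq ι] in
/-- Cancelling a non-zero integer scalar: `c X = c Y ⇒ X = Y`. [folklore] -/
private theorem smul_cancel_of_ne_zero {c : ℤ} (hc : c ≠ 0) {X Y : Matrix ι ι ℤ} (h : c • X = c • Y) :
    X = Y := by
  ext i j
  have hij := congrFun (congrFun h i) j
  rw [Matrix.smul_apply, Matrix.smul_apply, smul_eq_mul, smul_eq_mul] at hij
  exact mul_left_cancel₀ hc hij

/-! ### §1 (2.15)–(2.16): the ring `ℤ[δ] ≅ ℤ[t]/(Φ_ℓ(t))` -/

section Ring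

variable {D : Matrix ι ι ℤ} {n : ℕ}

/-- `Φ_n(D) = 0` over `ℚ` as well (the hypothesis shape of the cyclotomic matrix algebra of
`ComplexTorusCyclicGroupAction`). [cite: DolgachevZarhin2024, §2.2 (2.15) (chunk p0033)] -/
theorem aeval_map_cyclotomic_eq_zero (hD : aeval D (cyclotomic n ℤ) = 0) :
    aeval (D.map (Int.cast : ℤ → ℚ)) (cyclotomic n ℚ) = 0 := by
  rw [← map_cyclotomic_int, ← map_aeval_intCast, hD, Matrix.map_zero _ Int.cast_zero]

/-- **(2.15) is injective: "there is no polynomial `𝒫(t) ∈ ℤ[t]` not divisible by `Φ_ℓ(t)` such that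
`𝒫(δ) = 0`"** — for an integer matrix `D` with `Φ_n(D) = 0` (`n ≥ 1`, positive rank) and `P ∈ ℤ[t]`,
`P(D) = 0` implies `Φ_n ∣ P` in `ℤ[t]` (the minimal polynomial of `D` over `ℚ` is the irreducible `Φ_n`,
and `Φ_n` is monic, so divisibility descends to `ℤ[t]`; the notes argue with the resultant).
[cite: DolgachevZarhin2024, §2.2 (2.15)–(2.16) (chunks p0033–p0034)] -/
theorem cyclotomic_dvd_of_aeval_eq_zero [Nonempty ι] (hn : 0 < n) (hD : aeval D (cyclotomic n ℤ) = 0)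
    {P : ℤ[X]} (hP : aeval D P = 0) : cyclotomic n ℤ ∣ P := by
  have hmin := minpoly_eq_cyclotomic_of_aeval_eq_zero hn (aeval_map_cyclotomic_eq_zero hD)
  have hPQ : aeval (D.map (Int.cast : ℤ → ℚ)) (P.map (Int.castRingHom ℚ)) = 0 := by
    rw [← map_aeval_intCast, hP, Matrix.map_zero _ Int.cast_zero]
  have hdvd := minpoly.dvd ℚ _ hPQ
  rw [hmin, ← map_cyclotomic_int] at hdvd
  exact (Polynomial.map_dvd_map (Int.castRingHom ℚ) (Int.castRingHom ℚ).injective_int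
    (cyclotomic.monic n ℤ)).1 hdvd

/-- **`P(δ) = 0 ⟺ Φ_ℓ ∣ P`** — (2.15) is injective and well defined.
[cite: DolgachevZarhin2024, §2.2 (2.15)–(2.16) (chunks p0033–p0034)] -/
theorem aeval_eq_zero_iff_cyclotomic_dvd [Nonempty ι] (hn : 0 < n) (hD : aeval D (cyclotomic n ℤ) = 0)
    (P : ℤ[X]) : aeval D P = 0 ↔ cyclotomic n ℤ ∣ P :=
  ⟨cyclotomic_dvd_of_aeval_eq_zero hn hD, fun ⟨Q, hQ⟩ ↦ by rw [hQ, map_mul, hD, zero_mul]⟩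

/-- **"The map (2.15) is injective, and therefore, is a ring isomorphism `ℤ[t]/(Φ_ℓ(t)) ≅ ℤ[δ]`"**: the
kernel of the evaluation `ℤ[t] → M_ι(ℤ)`, `P ↦ P(δ)` — whose range is `ℤ[δ]`
(`Algebra.adjoin_singleton_eq_range_aeval`) — is exactly the ideal `(Φ_n)`.
[cite: DolgachevZarhin2024, §2.2 (2.15)–(2.16) (chunks p0033–p0034)] -/
theorem ker_aeval_eq_span_cyclotomic [Nonempty ι] (hn : 0 < n) (hD : aeval D (cyclotomic n ℤ) = 0) :
    RingHom.ker (aeval D : ℤ[X] →ₐ[ℤ] Matrix ι ι ℤ) = Ideal.span {cyclotomic n ℤ} := by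
  ext P
  rw [RingHom.mem_ker, Ideal.mem_span_singleton]
  exact aeval_eq_zero_iff_cyclotomic_dvd hn hD P

/-- **"Clearly `δ^ℓ` is the identity automorphism of `A`"**: `Φ_n(D) = 0` gives `D^n = 1`
(`Φ_n ∣ t^n - 1`). [cite: DolgachevZarhin2024, §2.2 (chunk p0033)] -/
theorem pow_eq_one_of_aeval_cyclotomic (hD : aeval D (cyclotomic n ℤ) = 0) : D ^ n = 1 := by
  obtain ⟨Q, hQ⟩ := cyclotomic.dvd_X_pow_sub_one n ℤ
  have h := congrArg (aeval D) hQ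
  rw [map_sub, map_pow, aeval_X, map_one, map_mul, hD, zero_mul, sub_eq_zero] at h
  exact h

/-- `δ` is an automorphism: `D` is invertible over `ℤ`. [cite: DolgachevZarhin2024, §2.2 ("`δ` be an automorphism", chunk p0033)] -/
theorem isUnit_of_aeval_cyclotomic (hn : 0 < n) (hD : aeval D (cyclotomic n ℤ) = 0) : IsUnit D :=
  (Units.ofPowEqOne D n (pow_eq_one_of_aeval_cyclotomic hD) hn.ne').isUnit

/-- On the torus: `ρ(D)^[n] = id`. [cite: DolgachevZarhin2024, §2.2 ("`δ^ℓ` is the identity automorphism of `A`", chunk p0033)] -/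
theorem iterate_mapMatrix_eq_id (Φ : (ι → ℝ) ≃L[ℝ] E) (hD : aeval D (cyclotomic n ℤ) = 0) :
    (mapMatrix Φ Φ D)^[n] = id := by
  rw [iterate_mapMatrix, pow_eq_one_of_aeval_cyclotomic hD]
  exact funext fun t ↦ mapMatrix_one t

/-! ### "`2 dim(A) = r(ℓ - 1)`": `φ(n) ∣ rk Λ`, `P_δ = Φ_n^r`, `det(1 - δ) = Φ_n(1)^r` -/

/-- **"The `ℤ`-rank arguments imply that `2 dim(A) = r(ℓ - 1)`"**: `φ(n)` divides `rk Λ = 2 dim A`.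
[cite: DolgachevZarhin2024, §2.2 ("`2 dim(A) = r(ℓ − 1)`", chunk p0034)] -/
theorem totient_dvd_card (hn : 0 < n) (hD : aeval D (cyclotomic n ℤ) = 0) : n.totient ∣ Fintype.card ι :=
  totient_dvd_card_of_aeval_cyclotomic_eq_zero hn (aeval_map_cyclotomic_eq_zero hD)

/-- **`P_δ = Φ_n^{r}`, `r = rk Λ/φ(n)`**: the characteristic polynomial of `ρ_r(δ)` (`Λ ⊗ ℚ ≅ ℚ(ζ)^r`).
[cite: DolgachevZarhin2024, §2.2 ("`Λ` is a direct sum `⊕ P_j` of `r` invertible `ℤ[δ]`-modules", chunk p0034)] -/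
theorem charpoly_eq_cyclotomic_pow [Nonempty ι] (hn : 0 < n) (hD : aeval D (cyclotomic n ℤ) = 0) :
    D.charpoly = cyclotomic n ℤ ^ (Fintype.card ι / n.totient) := by
  apply Polynomial.map_injective (Int.castRingHom ℚ) (Int.castRingHom ℚ).injective_int
  rw [← Matrix.charpoly_map, Polynomial.map_pow, map_cyclotomic_int]
  exact charpoly_eq_cyclotomic_pow_of_aeval_eq_zero hn (aeval_map_cyclotomic_eq_zero hD)

/-- **`det(1 - ρ_r(δ)) = Φ_n(1)^r`** (`= P_δ(1)`). [cite: DolgachevZarhin2024, §2.2 ("`A^δ = (1-δ)⁻¹Λ/Λ ≅ Λ/(1-δ)Λ`", chunk p0034)] -/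
theorem det_one_sub_eq_pow [Nonempty ι] (hn : 0 < n) (hD : aeval D (cyclotomic n ℤ) = 0) :
    (1 - D).det = ((cyclotomic n ℤ).eval 1) ^ (Fintype.card ι / n.totient) := by
  rw [← Polynomial.eval_pow, ← charpoly_eq_cyclotomic_pow hn hD, Matrix.eval_charpoly, map_one]

end Ring

/-! ### §2 The fixed group `A^δ` -/

section Fixed

variable (Φ : (ι → ℝ) ≃L[ℝ] E) (D : Matrix ι ι ℤ) {n : ℕ}

/-- **`A^δ = {x ∈ A ∣ δ(x) = x}`, the subgroup of fixed points of `δ = ρ(D)`**, as `Ker(1_A - δ)`.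
[cite: DolgachevZarhin2024, §2.2 ("the subgroup of fixed points of `δ`", chunk p0033)] -/
abbrev fixedSubgroup : AddSubgroup (ComplexTorus Φ) := (mapMatrixHom Φ Φ (1 - D)).ker

/-- `x ∈ A^δ ⟺ δ(x) = x`. [cite: DolgachevZarhin2024, §2.2 ("`A^δ = {x ∈ A ∣ δ(x) = x}`", chunk p0033)] -/
theorem mem_fixedSubgroup_iff (t : ComplexTorus Φ) : t ∈ fixedSubgroup Φ D ↔ mapMatrix Φ Φ D t = t := by
  rw [mem_ker_mapMatrixHom_iff, mapMatrix_one_sub, sub_eq_zero, eq_comm]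

/-- `A^δ` is the fixed-point set `Fix(ρ(D))`. [cite: DolgachevZarhin2024, §2.2 (chunk p0033)] -/
theorem coe_fixedSubgroup : (fixedSubgroup Φ D : Set (ComplexTorus Φ)) = fixedPoints (mapMatrix Φ Φ D) :=
  (fixedPoints_mapMatrix_eq_ker Φ D).symm

/-- `#A^δ = |det(1 - ρ_r(δ))|` (as `Nat.card`; `0` iff infinite). [cite: DolgachevZarhin2024, §2.2 ("`A^δ = (1-δ)⁻¹Λ/Λ`", chunk p0034)] -/
theorem natCard_fixedSubgroup : Nat.card (fixedSubgroup Φ D) = (1 - D).det.natAbs :=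
  natCard_ker_mapMatrixHom Φ Φ (1 - D)

variable {D}

/-- **`#A^δ = Φ_n(1)^{rk Λ/φ(n)}`** for `Φ_n(D) = 0` (positive rank, `n ≥ 1`): "`A^δ ≅ Λ/(1-δ)Λ`" counted
by `#Ker(1 - δ) = |det(1 - ρ_r(δ))| = |P_δ(1)|`. [cite: DolgachevZarhin2024, §2.2 ("`A^δ ≅ Λ/(1-δ)Λ ≅ … = 𝔽_ℓ^r`", chunk p0034)] -/
theorem natCard_fixedSubgroup_eq_pow [Nonempty ι] (hn : 0 < n) (hD : aeval D (cyclotomic n ℤ) = 0) :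
    Nat.card (fixedSubgroup Φ D) = ((cyclotomic n ℤ).eval 1).natAbs ^ (Fintype.card ι / n.totient) := by
  rw [natCard_fixedSubgroup, det_one_sub_eq_pow hn hD, Int.natAbs_pow]

/-- **"`dim_{𝔽_ℓ}(A^δ) = r = 2dim(A)/(ℓ - 1)`", counted: `#A^δ = ℓ^{rk Λ/(ℓ-1)}`** for `ℓ` prime (the notes
take `ℓ` odd; `ℓ = 2`, `δ = -1`, `A^δ = A[2]` is allowed here). [cite: DolgachevZarhin2024, §2.2 ("`dim_{𝔽_ℓ}(A^δ) = r = 2dim(A)/(ℓ−1)`", chunk p0034)] -/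
theorem natCard_fixedSubgroup_of_prime [Nonempty ι] {ℓ : ℕ} (hℓ : ℓ.Prime)
    (hD : aeval D (cyclotomic ℓ ℤ) = 0) : Nat.card (fixedSubgroup Φ D) = ℓ ^ (Fintype.card ι / (ℓ - 1)) := by
  haveI := Fact.mk hℓ
  rw [natCard_fixedSubgroup_eq_pow Φ hℓ.pos hD, eval_one_cyclotomic_prime, Int.natAbs_natCast,
    Nat.totient_prime hℓ]

/-- The prime-power case `n = p^{k+1}`: `#A^δ = p^{rk Λ/φ(p^{k+1})}` (`Φ_{p^{k+1}}(1) = p`).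
[cite: DolgachevZarhin2024, §2.2 (chunk p0034), general form] -/
theorem natCard_fixedSubgroup_of_prime_pow [Nonempty ι] {p : ℕ} (hp : p.Prime) (k : ℕ)
    (hD : aeval D (cyclotomic (p ^ (k + 1)) ℤ) = 0) :
    Nat.card (fixedSubgroup Φ D) = p ^ (Fintype.card ι / (p ^ (k + 1)).totient) := by
  haveI := Fact.mk hp
  rw [natCard_fixedSubgroup_eq_pow Φ (pow_pos hp.pos _) hD, eval_one_cyclotomic_prime_pow, Int.natAbs_natCast]

/-- When `n ≥ 2` is NOT a prime power, an automorphism with `Φ_n(δ) = 0` has no non-zero fixed point: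
`A^δ = 0` (`Φ_n(1) = 1`). [cite: DolgachevZarhin2024, §2.2 (chunk p0034), general form] -/
theorem fixedSubgroup_eq_bot_of_not_isPrimePow [Nonempty ι] (hn : 1 < n) (hnp : ¬ IsPrimePow n)
    (hD : aeval D (cyclotomic n ℤ) = 0) : fixedSubgroup Φ D = ⊥ := by
  refine AddSubgroup.eq_bot_of_card_eq _ ?_
  rw [natCard_fixedSubgroup_eq_pow Φ (zero_lt_one.trans hn) hD, eval_one_cyclotomic_not_prime_pow, Int.natAbs_one,
    one_pow]
  intro p hp k hk
  rcases k.eq_zero_or_pos with rfl | hk0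
  · rw [pow_zero] at hk; omega
  · exact hnp ⟨p, k, hp.prime, hk0, hk⟩

/-- **"there is `v ∈ ℤ[δ]` such that `v(1 - δ) = (1 - δ)v = ℓ`"** (`λ(1 - ζ_ℓ) = ℓ` in `ℤ[ζ_ℓ]`), general
form: `Φ_n(t) - Φ_n(1) = (t - 1) w(t)` gives `V = w(δ) ∈ ℤ[δ]` with `(1 - δ)V = V(1 - δ) = Φ_n(1)` (sign
absorbed into `w`). [cite: DolgachevZarhin2024, §2.2 proof of Lemma 2.19 (chunk p0037)] -/
theorem exists_one_sub_mul_eq_smul (hD : aeval D (cyclotomic n ℤ) = 0) :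
    ∃ V : Matrix ι ι ℤ, V ∈ Algebra.adjoin ℤ ({D} : Set (Matrix ι ι ℤ)) ∧ D * V = V * D ∧
      (1 - D) * V = ((cyclotomic n ℤ).eval 1) • (1 : Matrix ι ι ℤ) ∧
      V * (1 - D) = ((cyclotomic n ℤ).eval 1) • (1 : Matrix ι ι ℤ) := by
  obtain ⟨W, hW⟩ :
      X - C (1 : ℤ) ∣ cyclotomic n ℤ - C ((cyclotomic n ℤ).eval 1) := Polynomial.X_sub_C_dvd_sub_C_eval
  -- `Φ_n - Φ_n(1) = (t - 1) W`; evaluate at `D`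
  have h1 : -(((cyclotomic n ℤ).eval 1) • (1 : Matrix ι ι ℤ)) = (D - 1) * aeval D W := by
    have h := congrArg (aeval D) hW
    rw [map_sub, hD, zero_sub, map_mul, map_sub, aeval_X, aeval_C, aeval_C, map_one,
      Algebra.algebraMap_eq_smul_one] at h
    exact h
  have h2 : -(((cyclotomic n ℤ).eval 1) • (1 : Matrix ι ι ℤ)) = aeval D W * (D - 1) := by
    have h := congrArg (aeval D) ((mul_comm _ _).trans hW.symm).symm
    -- `Φ_n - C (Φ_n 1) = W * (X - 1)`
    rw [map_sub, hD, zero_sub, map_mul, map_sub, aeval_X, aeval_C, aeval_C, map_one,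
      Algebra.algebraMap_eq_smul_one] at h
    exact h
  refine ⟨aeval D W, Polynomial.aeval_mem_adjoin_singleton ℤ D, ?_, ?_, ?_⟩
  · have hc : aeval D (X * W) = aeval D (W * X) := by rw [mul_comm]
    rwa [map_mul, map_mul, aeval_X] at hc
  · rw [← neg_sub D 1, neg_mul, ← h1, neg_neg]
  · rw [← neg_sub D 1, mul_neg, ← h2, neg_neg]

/-- **`A^δ ⊆ A[Φ_n(1)]`**: every fixed point of `δ` is killed by the integer `Φ_n(1)` (apply `V` then
`1 - δ`). [cite: DolgachevZarhin2024, §2.2 ("`A^δ` … is contained in `A[ℓ]`", chunk p0033)] -/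
theorem eval_one_cyclotomic_zsmul_eq_zero (hD : aeval D (cyclotomic n ℤ) = 0) {t : ComplexTorus Φ}
    (ht : t ∈ fixedSubgroup Φ D) : ((cyclotomic n ℤ).eval 1) • t = 0 := by
  obtain ⟨V, -, -, -, hV⟩ := exists_one_sub_mul_eq_smul hD
  rw [mem_ker_mapMatrixHom_iff] at ht
  calc ((cyclotomic n ℤ).eval 1) • t = mapMatrix Φ Φ (((cyclotomic n ℤ).eval 1) • (1 : Matrix ι ι ℤ)) t := by
        rw [mapMatrix_smul, mapMatrix_one]
    _ = mapMatrix Φ Φ V (mapMatrix Φ Φ (1 - D) t) := by rw [← hV, mapMatrix_mapMatrix]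
    _ = 0 := by rw [ht]; exact map_zero (mapMatrixHom Φ Φ V)

/-- **"`A^δ` is contained in `A[ℓ]`"** for `ℓ` prime: `ℓ · x = 0` for every fixed point `x` of `δ`.
[cite: DolgachevZarhin2024, §2.2 ("`A^δ = {x ∈ A ∣ δ(x) = x}` is contained in `A[ℓ]`", chunk p0033)] -/
theorem prime_nsmul_eq_zero_of_mem_fixedSubgroup {ℓ : ℕ} (hℓ : ℓ.Prime) (hD : aeval D (cyclotomic ℓ ℤ) = 0)
    {t : ComplexTorus Φ} (ht : t ∈ fixedSubgroup Φ D) : ℓ • t = 0 := by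
  haveI := Fact.mk hℓ
  have h := eval_one_cyclotomic_zsmul_eq_zero Φ hD ht
  rwa [eval_one_cyclotomic_prime, natCast_zsmul] at h

/-- **"`A^δ ≅ 𝔽_ℓ^r`, `dim_{𝔽_ℓ}(A^δ) = r = 2dim(A)/(ℓ - 1)`"**: for `ℓ` prime and `Φ_ℓ(δ) = 0` the fixed
group is, as an abelian group, `(ℤ/ℓ)^{rk Λ/(ℓ-1)}` (an `ℓ`-torsion group of order `ℓ^r`).
[cite: DolgachevZarhin2024, §2.2 ("`A^δ ≅ … = 𝔽_ℓ^r`. This implies that `dim_{𝔽_ℓ}(A^δ) = r = 2dim(A)/(ℓ−1)`", chunk p0034)] -/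
theorem nonempty_addEquiv_fixedSubgroup [Nonempty ι] {ℓ : ℕ} (hℓ : ℓ.Prime)
    (hD : aeval D (cyclotomic ℓ ℤ) = 0) :
    Nonempty (fixedSubgroup Φ D ≃+ (Fin (Fintype.card ι / (ℓ - 1)) → ZMod ℓ)) := by
  haveI := Fact.mk hℓ
  set G := fixedSubgroup Φ D
  have htor : ∀ x : G, ℓ • x = 0 := fun x ↦
    Subtype.ext (prime_nsmul_eq_zero_of_mem_fixedSubgroup Φ hℓ hD x.2)
  -- `haveI`, not `letI`: the vector-space lemmas must see an opaque `ZMod ℓ`-module (`ZMod ℓ` a field)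
  haveI : Module (ZMod ℓ) G := AddCommGroup.zmodModule htor
  have hcard : Nat.card G = ℓ ^ (Fintype.card ι / (ℓ - 1)) := natCard_fixedSubgroup_of_prime Φ hℓ hD
  haveI : Finite G := Nat.finite_of_card_ne_zero (by rw [hcard]; exact pow_ne_zero _ hℓ.ne_zero)
  haveI : Module.Finite (ZMod ℓ) G := Module.Finite.of_finite
  have hrank : Module.finrank (ZMod ℓ) G = Fintype.card ι / (ℓ - 1) := by
    have h : Nat.card G = Nat.card (ZMod ℓ) ^ Module.finrank (ZMod ℓ) G := Module.natCard_eq_pow_finrank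
    rw [hcard, Nat.card_zmod] at h
    exact (Nat.pow_right_injective hℓ.two_le h).symm
  have e : G ≃ₗ[ZMod ℓ] (Fin (Fintype.card ι / (ℓ - 1)) → ZMod ℓ) :=
    LinearEquiv.ofFinrankEq G (Fin (Fintype.card ι / (ℓ - 1)) → ZMod ℓ)
      (by rw [hrank, Module.finrank_fin_fun])
  exact ⟨e.toAddEquiv⟩

end Fixed

/-! ### §3 `End_δ(A)`, Remark 2.17 and Lemma 2.19 -/

section Centralizer

variable (Φ : (ι → ℝ) ≃L[ℝ] E) (D : Matrix ι ι ℤ) {n : ℕ}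

/-- **`End_δ(A)`, the centralizer of `δ` in `End(A)`**, in the rational representation: the integer
matrices `U ∈ End(A)` (`endRingInt Φ`: `U ⊗ ℚ ∈ End_ℚ(A)`, i.e. `ρ(U)` holomorphic) commuting with `D`
— so the embedding (2.17) "`End_δ(A) ↪ End_{ℤ[δ]}(Λ)`, `f ↦ f_r`" is the inclusion
`centralizerEnd Φ D ≤ centralizer {D}`. [cite: DolgachevZarhin2024, §2.2 (2.17) and Theorem 2.18 ("`End(A)_δ` be the centralizer of `δ ∈ End(A)`", chunks p0035–p0036)] -/
def centralizerEnd : Subring (Matrix ι ι ℤ) := endRingInt Φ ⊓ Subring.centralizer {D}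

variable {Φ D} in
/-- Membership in `End_δ(A)`: an endomorphism commuting with `δ`. [cite: DolgachevZarhin2024, §2.2 (chunk p0035)] -/
theorem mem_centralizerEnd_iff {U : Matrix ι ι ℤ} :
    U ∈ centralizerEnd Φ D ↔ U ∈ endRingInt Φ ∧ D * U = U * D := by
  rw [centralizerEnd, Subring.mem_inf, Subring.mem_centralizer_iff]
  simp only [Set.mem_singleton_iff, forall_eq]

/-- (2.17): `End_δ(A) ⊆ End_{ℤ[δ]}(Λ)` (the integer matrices commuting with `δ`).
[cite: DolgachevZarhin2024, §2.2 (2.17) (chunk p0035)] -/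
theorem centralizerEnd_le_centralizer : centralizerEnd Φ D ≤ Subring.centralizer {D} := inf_le_right

variable {D}

/-- **Remark 2.17 / (2.18): "`Nu ∈ End_δ(A)` […] `(1/N)(Nu)_ℝ` is also a `ℂ`-linear self-map of `V`
[…] we conclude that `u ∈ End(A)`"**: if `Nu ∈ End_δ(A)` for an integer matrix `u` commuting with `δ`
and `N ≠ 0`, then `u ∈ End_δ(A)` ("the embedding (2.17) is bijective" as soon as
`N · End_{ℤ[δ]}(Λ) ⊂ End_δ(A)`); the saturation of `End(A)` in `End_ℤ(Λ)` is the tree's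
`mem_endRingInt_of_smul_mem`. [cite: DolgachevZarhin2024, §2.2 Remark 2.17, (2.18) (chunks p0035–p0036)] -/
theorem mem_centralizerEnd_of_zsmul_mem {N : ℤ} (hN : N ≠ 0) {U : Matrix ι ι ℤ} (hU : D * U = U * D)
    (h : N • U ∈ centralizerEnd Φ D) : U ∈ centralizerEnd Φ D :=
  mem_centralizerEnd_iff.2 ⟨mem_endRingInt_of_smul_mem Φ hN (mem_centralizerEnd_iff.1 h).1, hU⟩

/-- **Lemma 2.19 (i): `u(A^δ) ⊂ A^δ`** for `u` commuting with `δ` ("(i) is obvious":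
`(1 - δ)u x = u(1 - δ)x = 0`). [cite: DolgachevZarhin2024, §2.2 Lemma 2.19 (i) (chunk p0036)] -/
theorem mapMatrix_mem_fixedSubgroup {U : Matrix ι ι ℤ} (hU : D * U = U * D) {t : ComplexTorus Φ}
    (ht : t ∈ fixedSubgroup Φ D) : mapMatrix Φ Φ U t ∈ fixedSubgroup Φ D := by
  rw [mem_ker_mapMatrixHom_iff] at ht ⊢
  have hc : (1 - D) * U = U * (1 - D) := by rw [sub_mul, mul_sub, one_mul, mul_one, hU]
  rw [mapMatrix_mapMatrix, hc, ← mapMatrix_mapMatrix (Φ' := Φ), ht]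
  exact map_zero (mapMatrixHom Φ Φ U)

/-- **"`v(A[ℓ]) ⊂ A^δ`"**: for `V` with `(1 - δ)V = Φ_n(1)` and `x ∈ A[Φ_n(1)]`, `V x` is fixed by `δ`.
[cite: DolgachevZarhin2024, §2.2 proof of Lemma 2.19 (chunk p0037)] -/
theorem mapMatrix_mem_fixedSubgroup_of_torsion {V : Matrix ι ι ℤ} {c : ℤ}
    (hV : (1 - D) * V = c • (1 : Matrix ι ι ℤ)) {t : ComplexTorus Φ} (ht : c • t = 0) :
    mapMatrix Φ Φ V t ∈ fixedSubgroup Φ D := by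
  rw [mem_ker_mapMatrixHom_iff, mapMatrix_mapMatrix, hV, mapMatrix_smul, mapMatrix_one, ht]

/-- **Lemma 2.19 (ii): `u(A^δ) = {0}` if and only if `u ∈ (1 - δ)End(A)_δ`**, for `u ∈ End_δ(A)`,
`Φ_ℓ(δ) = 0`, `ℓ` prime. Proof as printed: "if" is obvious; "only if": `v(1 - δ) = (1 - δ)v = ℓ`,
`v(A[ℓ]) ⊂ A^δ`, so `uv(A[ℓ]) = 0` and `uv = ℓw` with `w ∈ End(A)` (Claim 2.7); cancelling gives
`u = (1 - δ)w`, and `w` commutes with `δ` because `u` does.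
[cite: DolgachevZarhin2024, §2.2 Lemma 2.19 (ii) and its proof (chunks p0036–p0037)] -/
theorem forall_fixed_eq_zero_iff [Nonempty ι] {ℓ : ℕ} (hℓ : ℓ.Prime) (hD : aeval D (cyclotomic ℓ ℤ) = 0)
    (hDe : D ∈ endRingInt Φ) {U : Matrix ι ι ℤ} (hU : U ∈ centralizerEnd Φ D) :
    (∀ t ∈ fixedSubgroup Φ D, mapMatrix Φ Φ U t = 0) ↔
      ∃ W ∈ centralizerEnd Φ D, U = (1 - D) * W := by
  haveI := Fact.mk hℓ
  constructor
  · intro h0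
    obtain ⟨V, hVadj, hDV, hV1, hV2⟩ := exists_one_sub_mul_eq_smul hD
    rw [eval_one_cyclotomic_prime] at hV1 hV2
    -- `uv` kills `A[ℓ]`
    have hUV : ∀ t : ComplexTorus Φ, ℓ • t = 0 → mapMatrix Φ Φ (U * V) t = 0 := fun t ht ↦ by
      rw [← mapMatrix_mapMatrix (Φ' := Φ)]
      exact h0 _ (mapMatrix_mem_fixedSubgroup_of_torsion Φ hV1 (by rwa [natCast_zsmul]))
    -- Claim 2.7: `uv = ℓ w`
    obtain ⟨W, hW⟩ := (forall_torsion_imp_eq_zero_iff_exists_eq_smul Φ Φ (U * V) hℓ.pos).1 hUV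
    have hℓ0 : (ℓ : ℤ) ≠ 0 := Int.natCast_ne_zero.2 hℓ.ne_zero
    -- `u ℓ = u v (1 - δ) = ℓ w (1 - δ)`, so `u = w (1 - δ)`
    have hUW : U = W * (1 - D) := by
      refine smul_cancel_of_ne_zero hℓ0 ?_
      rw [← Matrix.smul_mul, ← hW, Matrix.mul_assoc, hV2, Matrix.mul_smul, Matrix.mul_one]
    -- `w` commutes with `δ`: `(wδ - δw)(1 - δ) = uδ - δu = 0` and `1 - δ` is an isogeny
    have hdet : (1 - D).det ≠ 0 := by
      rw [det_one_sub_eq_pow hℓ.pos hD, eval_one_cyclotomic_prime]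
      exact pow_ne_zero _ hℓ0
    obtain ⟨hUe, hDU⟩ := mem_centralizerEnd_iff.1 hU
    have hDW : D * W = W * D := by
      refine mul_right_cancel_of_det_ne_zero hdet ?_
      have h1 : D * (1 - D) = (1 - D) * D := by rw [mul_sub, sub_mul, mul_one, one_mul]
      rw [Matrix.mul_assoc, ← hUW, Matrix.mul_assoc, h1, ← Matrix.mul_assoc, ← hUW, hDU]
    -- `w ∈ End(A)`: `ℓ w = uv ∈ End(A)` and `End(A)` is saturated
    have hVe : V ∈ endRingInt Φ := by
      have hle : Algebra.adjoin ℤ ({D} : Set (Matrix ι ι ℤ)) ≤ subalgebraOfSubring (endRingInt Φ) :=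
        Algebra.adjoin_le (Set.singleton_subset_iff.2 (mem_subalgebraOfSubring.2 hDe))
      exact mem_subalgebraOfSubring.1 (hle hVadj)
    have hWe : W ∈ endRingInt Φ :=
      mem_endRingInt_of_smul_mem Φ hℓ0 (hW ▸ (endRingInt Φ).mul_mem hUe hVe)
    refine ⟨W, mem_centralizerEnd_iff.2 ⟨hWe, hDW⟩, ?_⟩
    rw [hUW, mul_sub, sub_mul, mul_one, one_mul, hDW]
  · rintro ⟨W, hW, rfl⟩ t ht
    obtain ⟨-, hDW⟩ := mem_centralizerEnd_iff.1 hW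
    have hc : (1 - D) * W = W * (1 - D) := by rw [sub_mul, mul_sub, one_mul, mul_one, hDW]
    rw [mem_ker_mapMatrixHom_iff] at ht
    rw [hc, ← mapMatrix_mapMatrix (Φ' := Φ), ht]
    exact map_zero (mapMatrixHom Φ Φ W)

/-! #### (2.19): the action of `End_δ(A)` on `A^δ` and its kernel -/

variable (D) in
/-- **The action of `End_δ(A)` on `A^δ`** (Lemma 2.19 (i)): `u ↦ u|_{A^δ}`, a ring homomorphism
`End_δ(A) → End(A^δ)` — the map (2.19) before passing to the quotient.
[cite: DolgachevZarhin2024, §2.2 (2.19) (chunk p0036)] -/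
def fixedAction : centralizerEnd Φ D →+* AddMonoid.End (fixedSubgroup Φ D) where
  toFun U :=
    { toFun := fun t ↦ ⟨mapMatrix Φ Φ (U : Matrix ι ι ℤ) t,
        mapMatrix_mem_fixedSubgroup Φ (mem_centralizerEnd_iff.1 U.2).2 t.2⟩
      map_zero' := Subtype.ext (map_zero (mapMatrixHom Φ Φ (U : Matrix ι ι ℤ)))
      map_add' := fun s t ↦
        Subtype.ext (mapMatrix_add (U : Matrix ι ι ℤ) (s : ComplexTorus Φ) (t : ComplexTorus Φ)) }
  map_one' := AddMonoidHom.ext fun t ↦ Subtype.ext (mapMatrix_one (t : ComplexTorus Φ))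
  map_mul' U U' := AddMonoidHom.ext fun t ↦ Subtype.ext
    (mapMatrix_mapMatrix (Φ' := Φ) (Φ'' := Φ) (U : Matrix ι ι ℤ) (U' : Matrix ι ι ℤ)
      (t : ComplexTorus Φ)).symm
  map_zero' := AddMonoidHom.ext fun t ↦ Subtype.ext (by
    change mapMatrix Φ Φ (0 : Matrix ι ι ℤ) t = 0
    funext i
    simp only [mapMatrix_apply, Matrix.zero_apply, zero_smul, Finset.sum_const_zero]
    rfl)
  map_add' U U' := AddMonoidHom.ext fun t ↦ Subtype.ext
    (mapMatrix_add_matrix Φ Φ (U : Matrix ι ι ℤ) (U' : Matrix ι ι ℤ) (t : ComplexTorus Φ))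

/-- `fixedAction U t = U t`. [cite: DolgachevZarhin2024, §2.2 (2.19) (chunk p0036)] -/
theorem coe_fixedAction_apply (U : centralizerEnd Φ D) (t : fixedSubgroup Φ D) :
    ((fixedAction Φ D U t : fixedSubgroup Φ D) : ComplexTorus Φ) = mapMatrix Φ Φ (U : Matrix ι ι ℤ) t := rfl

/-- **Lemma 2.19 (ii) for the action map**: `u` acts as `0` on `A^δ` iff `u ∈ (1 - δ)End_δ(A)`.
[cite: DolgachevZarhin2024, §2.2 Lemma 2.19 (ii) (chunks p0036–p0037)] -/
theorem fixedAction_eq_zero_iff [Nonempty ι] {ℓ : ℕ} (hℓ : ℓ.Prime) (hD : aeval D (cyclotomic ℓ ℤ) = 0)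
    (hDe : D ∈ endRingInt Φ) (U : centralizerEnd Φ D) :
    fixedAction Φ D U = 0 ↔ ∃ W ∈ centralizerEnd Φ D, (U : Matrix ι ι ℤ) = (1 - D) * W := by
  rw [← forall_fixed_eq_zero_iff Φ hℓ hD hDe U.2]
  constructor
  · intro h t ht
    have h1 := congrArg (fun f : AddMonoid.End (fixedSubgroup Φ D) ↦
      ((f ⟨t, ht⟩ : fixedSubgroup Φ D) : ComplexTorus Φ)) h
    simp only [coe_fixedAction_apply] at h1
    exact h1.trans rfl
  · intro h
    exact AddMonoidHom.ext fun t ↦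
      Subtype.ext ((coe_fixedAction_apply Φ U t).trans ((h t t.2).trans rfl))

/-- `1 - δ ∈ End_δ(A)`. [cite: DolgachevZarhin2024, §2.2 ("`(1 - δ)End_δ(A)`", chunk p0036)] -/
theorem one_sub_mem_centralizerEnd (hDe : D ∈ endRingInt Φ) : 1 - D ∈ centralizerEnd Φ D :=
  mem_centralizerEnd_iff.2 ⟨(endRingInt Φ).sub_mem (endRingInt Φ).one_mem hDe,
    by rw [mul_sub, sub_mul, mul_one, one_mul]⟩

/-- **(2.19) is an embedding of `End_δ(A)/(1 - δ)End_δ(A)`**: the kernel of the action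
`End_δ(A) → End(A^δ)` is the ideal generated by the (central) element `1 - δ` of `End_δ(A)`.
[cite: DolgachevZarhin2024, §2.2 (2.19) and Lemma 2.19 (chunks p0036–p0037)] -/
theorem ker_fixedAction [Nonempty ι] {ℓ : ℕ} (hℓ : ℓ.Prime) (hD : aeval D (cyclotomic ℓ ℤ) = 0)
    (hDe : D ∈ endRingInt Φ) :
    RingHom.ker (fixedAction Φ D) = Ideal.span {⟨1 - D, one_sub_mem_centralizerEnd Φ hDe⟩} := by
  ext U
  rw [RingHom.mem_ker, fixedAction_eq_zero_iff Φ hℓ hD hDe, Ideal.mem_span_singleton']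
  constructor
  · rintro ⟨W, hW, hUW⟩
    -- `U = (1 - D) W = W (1 - D)` since `W` commutes with `D`
    refine ⟨⟨W, hW⟩, Subtype.ext ?_⟩
    obtain ⟨-, hDW⟩ := mem_centralizerEnd_iff.1 hW
    change W * (1 - D) = (U : Matrix ι ι ℤ)
    rw [hUW, sub_mul, mul_sub, one_mul, mul_one, hDW]
  · rintro ⟨W, hWU⟩
    refine ⟨W, W.2, ?_⟩
    obtain ⟨-, hDW⟩ := mem_centralizerEnd_iff.1 W.2
    have h := congrArg Subtype.val hWU
    change (W : Matrix ι ι ℤ) * (1 - D) = (U : Matrix ι ι ℤ) at h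
    rw [← h, sub_mul, mul_sub, one_mul, mul_one, hDW]

end Centralizer

end ComplexTorus

end Literature.Geometry.Kaehler

end
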